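import Literature.NumberTheory.Transcendental.KZIntervalPeriodProofs
import Literature.NumberTheory.Transcendental.SemialgebraicLineDeriv
import Literature.NumberTheory.Transcendental.KZCubicalCalculus
import Literature.NumberTheory.Transcendental.SemialgebraicMapsProofs
import Mathlib.Analysis.Calculus.Deriv.Comp
import Mathlib.Analysis.Calculus.Deriv.Mul
import Mathlib.Analysis.Convex.Basic

/-!
# `StokesGeneration` (stmt-KontsevichZagierPeriods-3586) — line `fibrewise_stokes`, stub `stub_rungTransportCertificate`

Registered rung stub R15 (rung 2′) of the line `fibrewise_stokes` of the crux `StokesGeneration`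
(route UnfoldedStokes): **the two-element transport certificate for the change-of-variables
relator of Kontsevich–Zagier's rule (2) in dimension one**, on the closed square `[0,1]²`
(coordinates `z = x 0`, `u = x 1`).

Let `φ` be an orientation-preserving `C¹` reparametrisation of `[0,1]` (`φ 0 = 0`, `φ 1 = 1`,
`φ [0,1] ⊆ [0,1]`, `φ (0,1) ⊆ (0,1)`, derivative `φ'` on `(0,1)`) and `f` a `C¹` integrand
(derivative `f'` on `(0,1)`), with `f`, `f'`, `φ`, `φ'` continuous on `[0,1]` and `ℚ`-semialgebraic
as functions of `x 0` on the square. The straight-line isotopy `φᵤ(z) = (1 − u) z + u φ(z)` from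
the identity to `φ` stays in `[0,1]` (in `(0,1)` for `z ∈ (0,1)`), and the one-dimensional
continuity equation `∂ᵤ[(f∘φᵤ) ∂_z φᵤ] = ∂_z[(f∘φᵤ) ∂ᵤ φᵤ]` (both sides equal
`f'(φᵤ) ∂ᵤφᵤ ∂_zφᵤ + f(φᵤ)(φ' − 1)`, no second derivative of `φ`) says that the primitives
`G₀ = −f(φᵤ z)·(φ z − z)` (direction `0`) and `G₁ = f(φᵤ z)·((1 − u) + u φ' z)` (direction `1`)
have fibre derivatives `D₀`, `D₁` with `D₀ + D₁ = 0`. The boundary values of `G₀` on `z = 0, 1`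
vanish (`φ` fixes the endpoints), while `G₁|_{u=1} − G₁|_{u=0} = f(φ z) φ'(z) − f(z)`. Hence the
rule-(2) relator `f(z) − f(φ z) φ'(z)` is the sum of the two fibrewise Stokes elements
`Dⱼ − (Gⱼ|_{xⱼ=1} − Gⱼ|_{xⱼ=0})`, carried by the closed square with continuous (hence integrable)
`ℚ`-semialgebraic integrands; `Gⱼ` is bounded on the compact square by continuity, and there is
no kink set (on the edges `z = 0, 1` the isotopy is constant in `u`, so `G₁` is affine along those
two fibres and still has fibre derivative `D₁`). Semialgebraicity of `f ∘ φᵤ`, `f' ∘ φᵤ`, `f ∘ φ` is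
composition of a `ℚ`-semialgebraic function with a `ℚ`-semialgebraic map of the square into itself
(Bochnak–Coste–Roy, Prop. 2.2.6, via Tarski–Seidenberg), the rest is closure under ring operations.

References: M. Kontsevich, D. Zagier, *Periods* (2001), §1.2, rule (2); J. Ayoub, *Une version
relative de la conjecture des périodes de Kontsevich–Zagier*, Ann. of Math. 181 (2015), Rem. 1.5;
J. Bochnak, M. Coste, M.-F. Roy, *Real Algebraic Geometry* (1998), Prop. 2.2.6.
-/

noncomputable section

-- `Summit.KontsevichZagierPeriods.KontsevichZagierPeriods.…` is the tree's mandated layout (single-conjunct summit).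
set_option linter.dupNamespace false

namespace Summit.KontsevichZagierPeriods.KontsevichZagierPeriods.Cruxes.StokesGeneration.FibrewiseStokes

open MeasureTheory Set
open Literature.NumberTheory.Transcendental
open Literature.NumberTheory.Transcendental.KZ
open Literature.ModelTheory.ExponentialFields (IsSemialgebraic)

/-! ## The straight-line isotopy stays in the interval -/

/-- A convex combination `(1 − t) a + t b` of two points of `[0,1]` with `t ∈ [0,1]` lies in
`[0,1]`. [folklore] -/
theorem rungTr_combo_mem_Icc {a b t : ℝ} (ha : a ∈ Set.Icc (0:ℝ) 1) (hb : b ∈ Set.Icc (0:ℝ) 1)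
    (ht : t ∈ Set.Icc (0:ℝ) 1) : (1 - t) * a + t * b ∈ Set.Icc (0:ℝ) 1 := by
  have h := convex_Icc (0:ℝ) 1 ha hb (sub_nonneg.2 ht.2) ht.1 (sub_add_cancel 1 t)
  simpa only [smul_eq_mul] using h

/-- A convex combination `(1 − t) a + t b` of two points of `(0,1)` with `t ∈ [0,1]` lies in
`(0,1)`. [folklore] -/
theorem rungTr_combo_mem_Ioo {a b t : ℝ} (ha : a ∈ Set.Ioo (0:ℝ) 1) (hb : b ∈ Set.Ioo (0:ℝ) 1)
    (ht : t ∈ Set.Icc (0:ℝ) 1) : (1 - t) * a + t * b ∈ Set.Ioo (0:ℝ) 1 := by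
  have h := convex_Ioo (0:ℝ) 1 ha hb (sub_nonneg.2 ht.2) ht.1 (sub_add_cancel 1 t)
  simpa only [smul_eq_mul] using h

/-! ## Semialgebraicity of a composite with a `[0,1]`-valued semialgebraic function -/

/-- If `h` is `ℚ`-semialgebraic as a function of `x 0` on the square and `g` is a `ℚ`-semialgebraic
function on the square with values in `[0,1]`, then `x ↦ h (g x)` is `ℚ`-semialgebraic on the
square: it is the composite of `y ↦ h (y 0)` with the semialgebraic self-map `x ↦ (g x, g x)` of the
square (Tarski–Seidenberg). [cite: BochnakCosteRoy1998, Prop. 2.2.6] -/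
theorem rungTr_isSemialgebraicFunOn_comp {h : ℝ → ℝ} {g : (Fin 2 → ℝ) → ℝ}
    (hh : IsSemialgebraicFunOn ℚ (Set.pi Set.univ (fun _ : Fin 2 => Set.Icc (0:ℝ) 1))
      (fun x => h (x 0)))
    (hg : IsSemialgebraicFunOn ℚ (Set.pi Set.univ (fun _ : Fin 2 => Set.Icc (0:ℝ) 1)) g)
    (hg01 : ∀ x ∈ Set.pi Set.univ (fun _ : Fin 2 => Set.Icc (0:ℝ) 1), g x ∈ Set.Icc (0:ℝ) 1) :
    IsSemialgebraicFunOn ℚ (Set.pi Set.univ (fun _ : Fin 2 => Set.Icc (0:ℝ) 1))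
      (fun x => h (g x)) := by
  have hSsa : IsSemialgebraic ℚ (Set.pi Set.univ (fun _ : Fin 2 => Set.Icc (0:ℝ) 1)) := by
    rw [← cube_eq_pi]; exact isSemialgebraic_cube
  have hΨ : IsSemialgebraicMapOn ℚ (Set.pi Set.univ (fun _ : Fin 2 => Set.Icc (0:ℝ) 1))
      (fun x => fun _ : Fin 2 => g x) :=
    IsSemialgebraicMapOn.of_forall hSsa fun _ => hg
  have hmaps : Set.MapsTo (fun x => fun _ : Fin 2 => g x)
      (Set.pi Set.univ (fun _ : Fin 2 => Set.Icc (0:ℝ) 1))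
      (Set.pi Set.univ (fun _ : Fin 2 => Set.Icc (0:ℝ) 1)) :=
    fun x hx => Set.mem_univ_pi.mpr fun _ => hg01 x hx
  exact IsSemialgebraicFunOn.comp_isSemialgebraicMapOn_holds hh hΨ hmaps

/-! ## Calculus of the two primitives along their fibres -/

/-- Direction `0` (along `z`, at fixed `u = c`): if `φ` is differentiable at `s` with derivative
`d` and `f` is differentiable at the isotopy point `(1 − c) s + c φ(s)` with derivative `e`, then
`d/dz [−f((1 − c) z + c φ z)·(φ z − z)]|_{z=s} = −(e ((1 − c) + c d) (φ s − s) + f(…) (d − 1))`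
(chain rule and product rule). [folklore] -/
theorem rungTr_hasDerivAt_dir0 {f φ : ℝ → ℝ} {c s d e : ℝ}
    (hf : HasDerivAt f e ((1 - c) * s + c * φ s)) (hφ : HasDerivAt φ d s) :
    HasDerivAt (fun u => -(f ((1 - c) * u + c * φ u) * (φ u - u)))
      (-(e * ((1 - c) + c * d) * (φ s - s) + f ((1 - c) * s + c * φ s) * (d - 1))) s := by
  have hin : HasDerivAt (fun u => (1 - c) * u + c * φ u) ((1 - c) * 1 + c * d) s :=
    ((hasDerivAt_id' s).const_mul (1 - c)).fun_add (hφ.const_mul c)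
  have hcomp : HasDerivAt (fun u => f ((1 - c) * u + c * φ u)) (e * ((1 - c) * 1 + c * d)) s :=
    hf.comp s hin
  refine ((hcomp.fun_mul (hφ.fun_sub (hasDerivAt_id' s))).fun_neg).congr_deriv ?_
  ring

/-- Direction `1` (along `u`, at fixed `z = a`, with `b = φ a`, `c = φ' a`): the fibre function
`u ↦ f((1 − u) a + u b)·((1 − u) + u c)` has derivative
`e (b − a) ((1 − s) + s c) + f(…) (c − 1)` at `u = s`, where either `f` is differentiable at the
isotopy point `(1 − s) a + s b` with derivative `e` (chain rule and product rule), or `b = a`, in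
which case the isotopy point is constantly `a` and the fibre function is affine in `u`.
[folklore] -/
theorem rungTr_hasDerivAt_dir1 {f : ℝ → ℝ} {a b c s e : ℝ}
    (hf : b = a ∨ HasDerivAt f e ((1 - s) * a + s * b)) :
    HasDerivAt (fun u => f ((1 - u) * a + u * b) * ((1 - u) + u * c))
      (e * (b - a) * ((1 - s) + s * c) + f ((1 - s) * a + s * b) * (c - 1)) s := by
  have hlin : HasDerivAt (fun u => (1 - u) + u * c) ((0 - 1) + 1 * c) s :=
    ((hasDerivAt_const s (1:ℝ)).fun_sub (hasDerivAt_id' s)).fun_add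
      ((hasDerivAt_id' s).mul_const c)
  rcases hf with hba | hf
  · -- the isotopy is constant along this fibre: `(1 - u) * a + u * a = a`
    rw [hba]
    have hfun : (fun u => f ((1 - u) * a + u * a) * ((1 - u) + u * c)) =
        fun u => f a * ((1 - u) + u * c) := by
      funext u
      rw [show (1 - u) * a + u * a = a by ring]
    rw [hfun, show (1 - s) * a + s * a = a by ring]
    refine (hlin.const_mul (f a)).congr_deriv ?_
    ring
  · have hin : HasDerivAt (fun u => (1 - u) * a + u * b) ((0 - 1) * a + 1 * b) s :=
      (((hasDerivAt_const s (1:ℝ)).fun_sub (hasDerivAt_id' s)).mul_const a).fun_add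
        ((hasDerivAt_id' s).mul_const b)
    have hcomp : HasDerivAt (fun u => f ((1 - u) * a + u * b)) (e * ((0 - 1) * a + 1 * b)) s :=
      hf.comp s hin
    refine (hcomp.fun_mul hlin).congr_deriv ?_
    ring

/-! ## The certificate -/

/-- **Registered stub `stub_rungTransportCertificate` (rung 2′, R15): the two-element transport
certificate for an orientation-preserving `C¹` reparametrisation `φ` of `[0,1]`** (`φ 0 = 0`,
`φ 1 = 1`, `φ (0,1) ⊆ (0,1)`, `φ [0,1] ⊆ [0,1]`) and a `C¹` integrand `f`, all `ℚ`-semialgebraic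
(as functions of `x 0` on the square): `f(x₀) − f(φ x₀)·φ′(x₀) = Σⱼ (qⱼ).integrand` with
primitives `G₀ = −f(φᵤ x₀)·(φ x₀ − x₀)` (direction `0`), `G₁ = f(φᵤ x₀)·((1 − x₁) + x₁ φ′ x₀)`
(direction `1`), `φᵤ x₀ = (1 − x₁) x₀ + x₁ φ x₀` the straight-line isotopy, fibre derivatives
`D₀ + D₁ = 0` (one-dimensional continuity equation); no kink set.
[cite: KontsevichZagier2001, §1.2 rule (2)] -/
theorem stub_rungTransportCertificate :
    ∀ (f f' φ φ' : ℝ → ℝ),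
      IsSemialgebraicFunOn ℚ (Set.pi Set.univ (fun _ : Fin 2 => Set.Icc (0:ℝ) 1)) (fun x => f (x 0)) →
      IsSemialgebraicFunOn ℚ (Set.pi Set.univ (fun _ : Fin 2 => Set.Icc (0:ℝ) 1)) (fun x => f' (x 0)) →
      IsSemialgebraicFunOn ℚ (Set.pi Set.univ (fun _ : Fin 2 => Set.Icc (0:ℝ) 1)) (fun x => φ (x 0)) →
      IsSemialgebraicFunOn ℚ (Set.pi Set.univ (fun _ : Fin 2 => Set.Icc (0:ℝ) 1)) (fun x => φ' (x 0)) →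
      ContinuousOn f (Set.Icc (0:ℝ) 1) → ContinuousOn f' (Set.Icc (0:ℝ) 1) →
      ContinuousOn φ (Set.Icc (0:ℝ) 1) → ContinuousOn φ' (Set.Icc (0:ℝ) 1) →
      (∀ u ∈ Set.Ioo (0:ℝ) 1, HasDerivAt f (f' u) u) → (∀ u ∈ Set.Ioo (0:ℝ) 1, HasDerivAt φ (φ' u) u) →
      φ 0 = 0 → φ 1 = 1 → (∀ u ∈ Set.Icc (0:ℝ) 1, φ u ∈ Set.Icc (0:ℝ) 1) →
      (∀ u ∈ Set.Ioo (0:ℝ) 1, φ u ∈ Set.Ioo (0:ℝ) 1) →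
      ∃ (G D : Fin 2 → (Fin 2 → ℝ) → ℝ) (q : Fin 2 → IntegralRep 2),
        (∀ j, IsSemialgebraicFunOn ℚ (Set.pi Set.univ (fun _ : Fin 2 => Set.Icc (0:ℝ) 1)) (G j) ∧
          IsSemialgebraicFunOn ℚ (Set.pi Set.univ (fun _ : Fin 2 => Set.Icc (0:ℝ) 1)) (D j) ∧
          (∃ B : ℝ, ∀ x ∈ Set.pi Set.univ (fun _ : Fin 2 => Set.Icc (0:ℝ) 1), |(G j) x| ≤ B) ∧
          (∀ x ∈ Set.pi Set.univ (fun _ : Fin 2 => Set.Icc (0:ℝ) 1),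
            ContinuousOn (fun s : ℝ => (G j) (Function.update x j s)) (Set.Icc (0:ℝ) 1)) ∧
          (∀ x ∈ Set.pi Set.univ (fun _ : Fin 2 => Set.Icc (0:ℝ) 1), x j ∈ Set.Ioo (0:ℝ) 1 →
            HasDerivAt (fun s : ℝ => (G j) (Function.update x j s)) ((D j) x) (x j))) ∧
        (∀ j, (q j).domain = Set.pi Set.univ (fun _ : Fin 2 => Set.Icc (0:ℝ) 1) ∧
          ∀ x ∈ Set.pi Set.univ (fun _ : Fin 2 => Set.Icc (0:ℝ) 1), (q j).integrand x =
            D j x - (G j (Function.update x j 1) - G j (Function.update x j 0))) ∧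
        ∀ x ∈ Set.pi Set.univ (fun _ : Fin 2 => Set.Icc (0:ℝ) 1),
          f (x 0) - f (φ (x 0)) * φ' (x 0) = ∑ j, (q j).integrand x := by
  intro f f' φ φ' hf hf' hφ hφ' hfc hf'c hφc hφ'c hderf hderφ hφ0 hφ1 hφI hφo
  -- the closed square and what holds on it
  set S : Set (Fin 2 → ℝ) := Set.pi Set.univ (fun _ : Fin 2 => Set.Icc (0:ℝ) 1) with hS
  have hSsa : IsSemialgebraic ℚ S := by rw [hS, ← cube_eq_pi]; exact isSemialgebraic_cube
  have hSc : IsCompact S := isCompact_univ_pi fun _ => isCompact_Icc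
  have h10 : (1 : Fin 2) ≠ 0 := by decide
  have h01 : (0 : Fin 2) ≠ 1 := by decide
  have hmem : ∀ x ∈ S, ∀ i, x i ∈ Set.Icc (0:ℝ) 1 := fun x hx i => (Set.mem_univ_pi.mp hx) i
  -- moving one coordinate inside `[0,1]` stays in the square
  have hupd : ∀ x ∈ S, ∀ (j : Fin 2), ∀ s ∈ Set.Icc (0:ℝ) 1, Function.update x j s ∈ S := by
    intro x hx j s hs
    refine Set.mem_univ_pi.mpr fun i => ?_
    rcases eq_or_ne i j with rfl | hij
    · simpa using hs
    · rw [Function.update_of_ne hij]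
      exact hmem x hx i
  -- the isotopy point `ψ x = (1 - u) z + u φ z` lies in `[0,1]`, and in `(0,1)` when `z ∈ (0,1)`
  set ψ : (Fin 2 → ℝ) → ℝ := fun x => (1 - x 1) * x 0 + x 1 * φ (x 0) with hψ
  have hψI : ∀ x ∈ S, ψ x ∈ Set.Icc (0:ℝ) 1 := fun x hx =>
    rungTr_combo_mem_Icc (hmem x hx 0) (hφI _ (hmem x hx 0)) (hmem x hx 1)
  have hψo : ∀ x ∈ S, x 0 ∈ Set.Ioo (0:ℝ) 1 → ψ x ∈ Set.Ioo (0:ℝ) 1 := fun x hx h0 =>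
    rungTr_combo_mem_Ioo h0 (hφo _ h0) (hmem x hx 1)
  -- semialgebraic atoms and building blocks on the square (BCR Prop. 2.2.6)
  have hx0sa : IsSemialgebraicFunOn ℚ S (fun x => x 0) := isSemialgebraicFunOn_apply hSsa 0
  have hx1sa : IsSemialgebraicFunOn ℚ S (fun x => x 1) := isSemialgebraicFunOn_apply hSsa 1
  have h1sa : IsSemialgebraicFunOn ℚ S (fun _ => (1:ℝ)) :=
    isSemialgebraicFunOn_const_of_isAlgebraic hSsa isAlgebraic_one
  have hψsa : IsSemialgebraicFunOn ℚ S ψ :=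
    ((h1sa.fun_sub hx1sa).fun_mul hx0sa).fun_add (hx1sa.fun_mul hφ)
  have hfψsa : IsSemialgebraicFunOn ℚ S (fun x => f (ψ x)) :=
    rungTr_isSemialgebraicFunOn_comp hf hψsa hψI
  have hf'ψsa : IsSemialgebraicFunOn ℚ S (fun x => f' (ψ x)) :=
    rungTr_isSemialgebraicFunOn_comp hf' hψsa hψI
  have hfφsa : IsSemialgebraicFunOn ℚ S (fun x => f (φ (x 0))) :=
    rungTr_isSemialgebraicFunOn_comp hf hφ fun x hx => hφI _ (hmem x hx 0)
  have hwsa : IsSemialgebraicFunOn ℚ S (fun x => (1 - x 1) + x 1 * φ' (x 0)) :=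
    (h1sa.fun_sub hx1sa).fun_add (hx1sa.fun_mul hφ')
  have hvsa : IsSemialgebraicFunOn ℚ S (fun x => φ (x 0) - x 0) := hφ.fun_sub hx0sa
  have hκsa : IsSemialgebraicFunOn ℚ S (fun x => φ' (x 0) - 1) := hφ'.fun_sub h1sa
  -- continuity atoms and building blocks on the square
  have hx0S : ContinuousOn (fun x : Fin 2 → ℝ => x 0) S := (continuous_apply 0).continuousOn
  have hx1S : ContinuousOn (fun x : Fin 2 → ℝ => x 1) S := (continuous_apply 1).continuousOn
  have hfS : ContinuousOn (fun x : Fin 2 → ℝ => f (x 0)) S := hfc.comp hx0S fun x hx => hmem x hx 0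
  have hφS : ContinuousOn (fun x : Fin 2 → ℝ => φ (x 0)) S := hφc.comp hx0S fun x hx => hmem x hx 0
  have hφ'S : ContinuousOn (fun x : Fin 2 → ℝ => φ' (x 0)) S :=
    hφ'c.comp hx0S fun x hx => hmem x hx 0
  have hψS : ContinuousOn ψ S := ((continuousOn_const.fun_sub hx1S).fun_mul hx0S).fun_add
    (hx1S.fun_mul hφS)
  have hfψS : ContinuousOn (fun x => f (ψ x)) S := hfc.comp hψS hψI
  have hf'ψS : ContinuousOn (fun x => f' (ψ x)) S := hf'c.comp hψS hψI
  have hfφS : ContinuousOn (fun x : Fin 2 → ℝ => f (φ (x 0))) S :=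
    hfc.comp hφS fun x hx => hφI _ (hmem x hx 0)
  have hwS : ContinuousOn (fun x : Fin 2 → ℝ => (1 - x 1) + x 1 * φ' (x 0)) S :=
    (continuousOn_const.fun_sub hx1S).fun_add (hx1S.fun_mul hφ'S)
  have hvS : ContinuousOn (fun x : Fin 2 → ℝ => φ (x 0) - x 0) S := hφS.fun_sub hx0S
  have hκS : ContinuousOn (fun x : Fin 2 → ℝ => φ' (x 0) - 1) S := hφ'S.fun_sub continuousOn_const
  -- the witnesses
  set G0 : (Fin 2 → ℝ) → ℝ := fun x => -(f (ψ x) * (φ (x 0) - x 0)) with hG0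
  set G1 : (Fin 2 → ℝ) → ℝ := fun x => f (ψ x) * ((1 - x 1) + x 1 * φ' (x 0)) with hG1
  set D0 : (Fin 2 → ℝ) → ℝ := fun x =>
    -(f' (ψ x) * ((1 - x 1) + x 1 * φ' (x 0)) * (φ (x 0) - x 0) + f (ψ x) * (φ' (x 0) - 1))
    with hD0
  set D1 : (Fin 2 → ℝ) → ℝ := fun x =>
    f' (ψ x) * (φ (x 0) - x 0) * ((1 - x 1) + x 1 * φ' (x 0)) + f (ψ x) * (φ' (x 0) - 1) with hD1
  -- the second integrand carries the boundary values of `G₁`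
  set I1 : (Fin 2 → ℝ) → ℝ := fun x => D1 x - (f (φ (x 0)) * φ' (x 0) - f (x 0)) with hI1
  -- semialgebraicity (closure under ring operations, BCR Prop. 2.2.6)
  have hG0sa : IsSemialgebraicFunOn ℚ S G0 := (hfψsa.fun_mul hvsa).fun_neg
  have hG1sa : IsSemialgebraicFunOn ℚ S G1 := hfψsa.fun_mul hwsa
  have hD0sa : IsSemialgebraicFunOn ℚ S D0 :=
    (((hf'ψsa.fun_mul hwsa).fun_mul hvsa).fun_add (hfψsa.fun_mul hκsa)).fun_neg
  have hD1sa : IsSemialgebraicFunOn ℚ S D1 :=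
    ((hf'ψsa.fun_mul hvsa).fun_mul hwsa).fun_add (hfψsa.fun_mul hκsa)
  have hI1sa : IsSemialgebraicFunOn ℚ S I1 := hD1sa.fun_sub ((hfφsa.fun_mul hφ').fun_sub hf)
  -- continuity on the square
  have hG0c : ContinuousOn G0 S := (hfψS.fun_mul hvS).fun_neg
  have hG1c : ContinuousOn G1 S := hfψS.fun_mul hwS
  have hD0c : ContinuousOn D0 S :=
    (((hf'ψS.fun_mul hwS).fun_mul hvS).fun_add (hfψS.fun_mul hκS)).fun_neg
  have hD1c : ContinuousOn D1 S := ((hf'ψS.fun_mul hvS).fun_mul hwS).fun_add (hfψS.fun_mul hκS)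
  have hI1c : ContinuousOn I1 S := hD1c.fun_sub ((hfφS.fun_mul hφ'S).fun_sub hfS)
  -- packaged as `Fin 2`-families
  set G : Fin 2 → (Fin 2 → ℝ) → ℝ := ![G0, G1] with hG
  set D : Fin 2 → (Fin 2 → ℝ) → ℝ := ![D0, D1] with hD
  set I : Fin 2 → (Fin 2 → ℝ) → ℝ := ![D0, I1] with hI
  have hGsa : ∀ j, IsSemialgebraicFunOn ℚ S (G j) := Fin.forall_fin_two.2 ⟨hG0sa, hG1sa⟩
  have hDsa : ∀ j, IsSemialgebraicFunOn ℚ S (D j) := Fin.forall_fin_two.2 ⟨hD0sa, hD1sa⟩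
  have hIsa : ∀ j, IsSemialgebraicFunOn ℚ S (I j) := Fin.forall_fin_two.2 ⟨hD0sa, hI1sa⟩
  have hGc : ∀ j, ContinuousOn (G j) S := Fin.forall_fin_two.2 ⟨hG0c, hG1c⟩
  have hIc : ∀ j, ContinuousOn (I j) S := Fin.forall_fin_two.2 ⟨hD0c, hI1c⟩
  -- boundary values: `G₀` vanishes on `z = 1` and `z = 0` since `φ` fixes the endpoints
  have hG0_one : ∀ x, G 0 (Function.update x 0 1) = 0 := fun x => by
    simp only [hG, hG0, Matrix.cons_val_zero, Function.update_self, hφ1]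
    ring
  have hG0_zero : ∀ x, G 0 (Function.update x 0 0) = 0 := fun x => by
    simp only [hG, hG0, Matrix.cons_val_zero, Function.update_self, hφ0]
    ring
  -- boundary values: `G₁|_{u=1} = f(φ z) φ' z` and `G₁|_{u=0} = f z`
  have hG1_one : ∀ x, G 1 (Function.update x 1 1) = f (φ (x 0)) * φ' (x 0) := fun x => by
    simp only [hG, hG1, hψ, Matrix.cons_val_one, Matrix.cons_val_fin_one, Function.update_self,
      Function.update_of_ne h01, sub_self, zero_mul, one_mul, zero_add]
  have hG1_zero : ∀ x, G 1 (Function.update x 1 0) = f (x 0) := fun x => by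
    simp only [hG, hG1, hψ, Matrix.cons_val_one, Matrix.cons_val_fin_one, Function.update_self,
      Function.update_of_ne h01, sub_zero, zero_mul, one_mul, add_zero, mul_one]
  -- bounds on the compact square
  have hGbd : ∀ j, ∃ B : ℝ, ∀ x ∈ S, |G j x| ≤ B := fun j => by
    obtain ⟨B, hB⟩ := hSc.exists_bound_of_continuousOn (hGc j)
    exact ⟨B, fun x hx => by simpa only [Real.norm_eq_abs] using hB x hx⟩
  -- continuity along closed fibres
  have hGfib : ∀ j, ∀ x ∈ S,
      ContinuousOn (fun s : ℝ => G j (Function.update x j s)) (Set.Icc (0:ℝ) 1) := by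
    intro j x hx
    have hc : Continuous fun s : ℝ => Function.update x j s :=
      continuous_const.update j continuous_id
    exact (hGc j).comp hc.continuousOn fun s hs => hupd x hx j s hs
  -- derivatives along open fibres (the one-dimensional continuity equation)
  have hGder : ∀ j, ∀ x ∈ S, x j ∈ Set.Ioo (0:ℝ) 1 →
      HasDerivAt (fun s : ℝ => G j (Function.update x j s)) (D j x) (x j) := by
    refine Fin.forall_fin_two.2 ⟨fun x hx hx0 => ?_, fun x hx _ => ?_⟩
    · have hfun : (fun s : ℝ => G 0 (Function.update x 0 s)) =
          fun s => -(f ((1 - x 1) * s + x 1 * φ s) * (φ s - s)) := by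
        funext s
        simp only [hG, hG0, hψ, Matrix.cons_val_zero, Function.update_self,
          Function.update_of_ne h10]
      have hDx : D 0 x =
          -(f' ((1 - x 1) * x 0 + x 1 * φ (x 0)) * ((1 - x 1) + x 1 * φ' (x 0)) * (φ (x 0) - x 0) +
            f ((1 - x 1) * x 0 + x 1 * φ (x 0)) * (φ' (x 0) - 1)) := by
        simp only [hD, hD0, hψ, Matrix.cons_val_zero]
      rw [hfun, hDx]
      exact rungTr_hasDerivAt_dir0 (hderf _ (hψo x hx hx0)) (hderφ _ hx0)
    · have hfun : (fun s : ℝ => G 1 (Function.update x 1 s)) =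
          fun s => f ((1 - s) * x 0 + s * φ (x 0)) * ((1 - s) + s * φ' (x 0)) := by
        funext s
        simp only [hG, hG1, hψ, Matrix.cons_val_one, Matrix.cons_val_fin_one, Function.update_self,
          Function.update_of_ne h01]
      have hDx : D 1 x =
          f' ((1 - x 1) * x 0 + x 1 * φ (x 0)) * (φ (x 0) - x 0) * ((1 - x 1) + x 1 * φ' (x 0)) +
            f ((1 - x 1) * x 0 + x 1 * φ (x 0)) * (φ' (x 0) - 1) := by
        simp only [hD, hD1, hψ, Matrix.cons_val_one, Matrix.cons_val_fin_one]
      rw [hfun, hDx]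
      refine rungTr_hasDerivAt_dir1 ?_
      -- on the edges `z = 0`, `z = 1` the isotopy is constant (`φ` fixes the endpoints);
      -- in between, `f` is differentiable at the isotopy point, which lies in `(0,1)`
      rcases (hmem x hx 0).1.eq_or_lt with h0 | h0
      · exact Or.inl (by rw [← h0]; exact hφ0)
      rcases (hmem x hx 0).2.eq_or_lt with h1 | h1
      · exact Or.inl (by rw [h1]; exact hφ1)
      exact Or.inr (hderf _ (hψo x hx ⟨h0, h1⟩))
  -- the two closed-square representations
  let q : Fin 2 → IntegralRep 2 := fun j =>
    { domain := S
      integrand := I j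
      isSemialgebraic_domain := hSsa
      isSemialgebraicFunOn_integrand := hIsa j
      integrableOn := (hIc j).integrableOn_compact hSc }
  refine ⟨G, D, q, fun j => ⟨hGsa j, hDsa j, hGbd j, hGfib j, hGder j⟩, ?_, fun x _ => ?_⟩
  · -- the integrand clauses
    refine Fin.forall_fin_two.2 ⟨⟨rfl, fun x _ => ?_⟩, ⟨rfl, fun x _ => ?_⟩⟩
    · show I 0 x = D 0 x - (G 0 (Function.update x 0 1) - G 0 (Function.update x 0 0))
      rw [hG0_one, hG0_zero, sub_zero, sub_zero]
      simp only [hI, hD, Matrix.cons_val_zero]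
    · show I 1 x = D 1 x - (G 1 (Function.update x 1 1) - G 1 (Function.update x 1 0))
      rw [hG1_one, hG1_zero]
      simp only [hI, hI1, hD, Matrix.cons_val_one, Matrix.cons_val_fin_one]
  · -- the identity `f z − f(φ z) φ' z = D₀ + (D₁ − (f(φ z) φ' z − f z))`, as `D₀ + D₁ = 0`
    show f (x 0) - f (φ (x 0)) * φ' (x 0) = ∑ j, I j x
    rw [Fin.sum_univ_two]
    simp only [hI, hI1, hD0, hD1, Matrix.cons_val_zero, Matrix.cons_val_one,
      Matrix.cons_val_fin_one]
    ring

end Summit.KontsevichZagierPeriods.KontsevichZagierPeriods.Cruxes.StokesGeneration.FibrewiseStokes
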